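import Mathlib.LinearAlgebra.FreeModule.PID
import Mathlib.LinearAlgebra.Dimension.Constructions
import Mathlib.RingTheory.DiscreteValuationRing.Basic
import Mathlib.RingTheory.UniqueFactorizationDomain.Multiplicity
import Mathlib.NumberTheory.Padics.PadicIntegers
import Literature.IUT.LogVolume.LatticeAutomorphisms
import HarnessLib

/-!
# The fork at [IUTchIII] Cor. 3.12 — lattice algebra for the (Ind2) hull LOWER bound: `GL(Λ)` is transitive on
# primitive vectors and the span of a `GL(Λ)`-orbit is `p^m Λ` (abc-iut cell, record-only support file)

Standard lattice algebra, absent from Mathlib in this form (searched: `unimodular`, `primitive`, `IsPrimitive`,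
`Basis.SmithNormalForm` consumers): over a principal ideal domain `R`, a nonzero vector `v` of a finite free
`R`-module `M` is *primitive* (`a • m = v ⇒ a` is a unit) iff it is a member of some basis of `M`; hence the
automorphism group `GL(M)` acts TRANSITIVELY on primitive vectors. Over a discrete valuation ring with uniformiser
`ϖ` (e.g. `ℤ_[p]`, `ϖ = p`), primitive means `∉ ϖM`, every `x ≠ 0` is `ϖ^m • y` with `y` primitive, and therefore
the `R`-span of the `GL(M)`-orbit of `x` is EXACTLY `ϖ^m • M`.

* `isUnit_of_smul_eq_basis` — basis vectors are primitive;
* `exists_basis_apply_eq_of_primitive` — a primitive vector is the `0`-th vector of a basis indexed by `Fin (n+1)`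
  (Smith normal form of `R ∙ v ≤ M`, Mathlib `Submodule.smithNormalForm`, as in `LatticeSaturation.lean`);
* `exists_linearEquiv_apply_eq_of_primitive` — `GL(M)` is transitive on primitive vectors;
* `primitive_of_not_mem_smul_top` — over a DVR, `y ∉ ϖ • ⊤` implies `y` primitive;
* `span_orbit_eq_smul_top` — over a DVR, for `y ∉ ϖ • ⊤` the span of the `GL(M)`-orbit of `ϖ^m • y` is `ϖ^m • ⊤`;
* `span_orbit_eq_smul_top_padicInt` — the instance `R = ℤ_[p]`, `ϖ = p`;
* `exists_latticeAut_extends` — for a FULL lattice `Λ = span_A (range c)` (`c` a `K`-basis of `W`) every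
  `A`-linear automorphism of `Λ` extends to a member of the tree's `latticeAut K Λ`
  (`Literature.IUT.LogVolume.LatticeAutomorphisms`, Dupuy–Hilado §4.9 `Aut_{ℚ_p}(V : Λ)` = c312-3's `indTwo`);
* `span_latticeAut_orbit_eq` — hence the `A`-span of the `latticeAut K Λ`-orbit of `ϖ^m • y` (`y ∈ Λ ∖ ϖΛ`) is
  `ϖ^m • Λ`, and `exists_span_latticeAut_orbit_eq` for any nonzero `x ∈ Λ`.

Motivation (abc-iut cell, skeleton memo HOME/skel/FORK-REAL-MODEL.md §4, "MISSING FOR A TWO-SIDED KERNEL STATEMENT"):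
with the full lattice automorphism group as the (Ind2) indeterminacy (`indTwo = latticeAut ℚ_[p] (log_p(R_I^×))`,
`TensorPacketShell.lean`), the holomorphic hull of the (Ind2)-orbit of a region containing a lattice vector outside
`p^{m+1}Λ` contains all of `p^m Λ` — the lower bound matching [IUTchIV] Prop. 1.2 (ii)'s upper bound, which is what
makes the sharp-real-model statement two-sided. This file is pure linear algebra over Mathlib + the tree's
`latticeAut`; it takes no side on [IUTchIII] Cor. 3.12 and types no reading. [folklore]
-/

namespace Summit.ABC.IUTFork.LatticeOrbit

open Module Submodule
open scoped Pointwise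

section PID

variable {R : Type*} [CommRing R] [IsDomain R] [IsPrincipalIdealRing R]
variable {M : Type*} [AddCommGroup M] [Module R M] [Module.Free R M] [Module.Finite R M]

omit [IsDomain R] [IsPrincipalIdealRing R] [Module.Free R M] [Module.Finite R M] in
/-- Basis vectors are primitive: if `a • m = b i` then `a` is a unit (apply the `i`-th coordinate). [folklore] -/
theorem isUnit_of_smul_eq_basis {ι : Type*} (b : Basis ι R M) (i : ι) (a : R) (m : M) (h : a • m = b i) :
    IsUnit a := by
  classical
  have h1 : a * b.repr m i = 1 := by
    have := congrArg (fun x => b.repr x i) h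
    simpa [Finsupp.single_apply] using this
  exact IsUnit.of_mul_eq_one _ h1

/-- **A primitive vector extends to a basis.** Over a PID, a nonzero `v` such that `a • m = v` forces `a` to be a unit
is the `0`-th vector of a basis of `M` indexed by `Fin (n + 1)`. Proof: Smith normal form of `R ∙ v ≤ M` gives a basis
`bM` of `M` and `a₀` with `a₀ • bM (f 0)` generating `R ∙ v`; primitivity makes `v` a unit multiple of `bM (f 0)`.
[folklore] -/
theorem exists_basis_apply_eq_of_primitive (v : M) (hv0 : v ≠ 0)
    (hv : ∀ (a : R) (m : M), a • m = v → IsUnit a) :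
    ∃ (n : ℕ) (b : Basis (Fin (n + 1)) R M), b 0 = v := by
  classical
  obtain ⟨k, bM, bN, f, a, snf⟩ := Submodule.smithNormalForm (Module.Free.chooseBasis R M) (R ∙ v)
  -- the rank of `R ∙ v` is `1`
  haveI : Nontrivial (R ∙ v) := ⟨⟨⟨v, mem_span_singleton_self v⟩, 0, fun h => hv0 (by simpa using h)⟩⟩
  have hk1 : k = 1 := by
    have hne : k ≠ 0 := by
      obtain ⟨i⟩ := bN.index_nonempty
      exact Nat.pos_iff_ne_zero.mp (Nat.lt_of_le_of_lt (Nat.zero_le _) i.isLt)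
    have hle : k ≤ 1 := by
      have h1 : finrank R (R ∙ v) = k := by simpa using finrank_eq_card_basis bN
      have h2 : finrank R (R ∙ v) ≤ 1 := by
        simpa using finrank_span_le_card (R := R) ({v} : Set M)
      omega
    omega
  subst hk1
  -- `v` is a unit multiple of `bM (f 0)`
  have hmem : (bN 0 : M) ∈ R ∙ v := (bN 0).2
  have hvN : v ∈ span R (Set.range fun i : Fin 1 => (bN i : M)) := by
    have : (⟨v, mem_span_singleton_self v⟩ : R ∙ v) ∈ span R (Set.range bN) := by
      rw [bN.span_eq]; trivial
    have h := Submodule.mem_map_of_mem (f := (R ∙ v).subtype) this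
    rw [Submodule.map_span] at h
    simpa [← Set.range_comp, Function.comp_def] using h
  rw [show (Set.range fun i : Fin 1 => (bN i : M)) = {(bN 0 : M)} by
    ext x; simp [Fin.exists_fin_one, eq_comm]] at hvN
  obtain ⟨c, hc⟩ := mem_span_singleton.mp hvN
  rw [snf 0, smul_smul] at hc
  obtain ⟨u, hu⟩ := hv _ _ hc
  -- rescale the `f 0`-th basis vector by `u` and move it to index `0`
  let w : Free.ChooseBasisIndex R M → Rˣ := Function.update 1 (f 0) u
  let b₁ := bM.unitsSMul w
  have hb₁ : b₁ (f 0) = v := by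
    simp only [b₁, Basis.unitsSMul_apply, w, Function.update_self, ← hc, ← hu]
    rfl
  have hcard : 1 ≤ Fintype.card (Free.ChooseBasisIndex R M) := Fintype.card_pos_iff.mpr ⟨f 0⟩
  obtain ⟨n, hn⟩ : ∃ n, Fintype.card (Free.ChooseBasisIndex R M) = n + 1 :=
    ⟨Fintype.card (Free.ChooseBasisIndex R M) - 1, by omega⟩
  let e₀ : Free.ChooseBasisIndex R M ≃ Fin (n + 1) :=
    (Fintype.equivFin (Free.ChooseBasisIndex R M)).trans (finCongr hn)
  let e : Free.ChooseBasisIndex R M ≃ Fin (n + 1) := e₀.trans (Equiv.swap (e₀ (f 0)) 0)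
  refine ⟨n, b₁.reindex e, ?_⟩
  rw [Basis.reindex_apply]
  have : e.symm 0 = f 0 := by
    rw [Equiv.symm_apply_eq]
    simp [e]
  rw [this, hb₁]

/-- **`GL(M)` is transitive on primitive vectors**: over a PID, for two nonzero primitive vectors `v`, `w` of a
finite free module there is a linear automorphism `g` with `g v = w`. [folklore] -/
theorem exists_linearEquiv_apply_eq_of_primitive (v w : M) (hv0 : v ≠ 0)
    (hv : ∀ (a : R) (m : M), a • m = v → IsUnit a) (hw0 : w ≠ 0)
    (hw : ∀ (a : R) (m : M), a • m = w → IsUnit a) :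
    ∃ g : M ≃ₗ[R] M, g v = w := by
  obtain ⟨n, b, hb⟩ := exists_basis_apply_eq_of_primitive v hv0 hv
  obtain ⟨n', b', hb'⟩ := exists_basis_apply_eq_of_primitive w hw0 hw
  have hn : n + 1 = n' + 1 := by simpa using Fintype.card_congr (b.indexEquiv b')
  refine ⟨b.equiv b' (finCongr hn), ?_⟩
  rw [← hb, Basis.equiv_apply, ← hb']
  rfl

end PID

section DVR

variable {R : Type*} [CommRing R] [IsDomain R] [IsDiscreteValuationRing R]
variable {M : Type*} [AddCommGroup M] [Module R M] [Module.Free R M] [Module.Finite R M]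

omit [Module.Free R M] [Module.Finite R M] in
/-- Over a DVR with uniformiser `ϖ`: a vector outside `ϖ • M` is primitive (a non-unit scalar lies in `(ϖ)`).
[folklore] -/
theorem primitive_of_not_mem_smul_top {ϖ : R} (hϖ : Irreducible ϖ) {y : M}
    (hy : y ∉ ϖ • (⊤ : Submodule R M)) (a : R) (m : M) (h : a • m = y) : IsUnit a := by
  by_contra ha
  have hmem : a ∈ IsLocalRing.maximalIdeal R := ha
  rw [hϖ.maximalIdeal_eq, Ideal.mem_span_singleton] at hmem
  obtain ⟨r, rfl⟩ := hmem
  exact hy ((mem_smul_pointwise_iff_exists _ _ _).mpr ⟨r • m, mem_top, by rw [← h, smul_smul]⟩)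

omit [IsDomain R] [IsDiscreteValuationRing R] [Module.Free R M] [Module.Finite R M] in
/-- A vector outside `ϖ • M` is nonzero. [folklore] -/
theorem ne_zero_of_not_mem_smul_top {ϖ : R} {y : M} (hy : y ∉ ϖ • (⊤ : Submodule R M)) : y ≠ 0 := by
  rintro rfl
  exact hy (Submodule.zero_mem _)

/-- **The span of a `GL(M)`-orbit over a DVR.** For `y ∉ ϖ • M` (uniformiser `ϖ`) and `x = ϖ^m • y`, the
`R`-span of the orbit `{g x | g ∈ GL(M)}` is exactly `ϖ^m • M`: `⊆` since `g x = ϖ^m • g y`; `⊇` since every basis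
vector `b i` is primitive, so some `g` maps `y ↦ b i` and `x ↦ ϖ^m • b i`, and these span `ϖ^m • M`. [folklore] -/
theorem span_orbit_eq_smul_top {ϖ : R} (hϖ : Irreducible ϖ) (m : ℕ) {y : M}
    (hy : y ∉ ϖ • (⊤ : Submodule R M)) :
    span R (Set.range fun g : M ≃ₗ[R] M => g (ϖ ^ m • y)) = ϖ ^ m • (⊤ : Submodule R M) := by
  classical
  have hy0 : y ≠ 0 := ne_zero_of_not_mem_smul_top hy
  have hyp := primitive_of_not_mem_smul_top hϖ hy
  apply le_antisymm
  · rw [span_le]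
    rintro _ ⟨g, rfl⟩
    show g (ϖ ^ m • y) ∈ ϖ ^ m • (⊤ : Submodule R M)
    rw [map_smul]
    exact smul_mem_pointwise_smul _ _ _ mem_top
  · intro z hz
    obtain ⟨s, -, rfl⟩ := (mem_smul_pointwise_iff_exists _ _ _).mp hz
    let b := Module.Free.chooseBasis R M
    -- every `ϖ^m • b i` lies in the orbit
    have hbi : ∀ i, ϖ ^ m • b i ∈ span R (Set.range fun g : M ≃ₗ[R] M => g (ϖ ^ m • y)) := by
      intro i
      obtain ⟨g, hg⟩ := exists_linearEquiv_apply_eq_of_primitive y (b i) hy0 hyp (b.ne_zero i)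
        (isUnit_of_smul_eq_basis b i)
      refine subset_span ⟨g, ?_⟩
      simp only [map_smul, hg]
    rw [← b.sum_repr s, Finset.smul_sum]
    refine Submodule.sum_mem _ fun i _ => ?_
    rw [smul_comm]
    exact Submodule.smul_mem _ _ (hbi i)

/-- **Every nonzero vector is `ϖ^m •` a primitive one** (finite free module over a DVR): `x ≠ 0` can be written
`x = ϖ^m • y` with `y ∉ ϖ • M`. [folklore] -/
theorem exists_eq_pow_smul_not_mem {ϖ : R} (hϖ : Irreducible ϖ) {x : M} (hx : x ≠ 0) :
    ∃ (m : ℕ) (y : M), x = ϖ ^ m • y ∧ y ∉ ϖ • (⊤ : Submodule R M) := by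
  classical
  -- the set of exponents `m` with `x ∈ ϖ^m • M` is bounded: use a coordinate where `x` is nonzero
  let b := Module.Free.chooseBasis R M
  obtain ⟨i, hi⟩ : ∃ i, b.repr x i ≠ 0 := by
    by_contra h
    push Not at h
    exact hx (b.repr.injective (by ext j; simp [h j]))
  -- `P m := x ∈ ϖ^m • ⊤`; `P 0` holds and `P` fails beyond the valuation of the `i`-th coordinate
  have hP0 : x ∈ ϖ ^ 0 • (⊤ : Submodule R M) := by simp
  have hbound : ∀ k, x ∈ ϖ ^ k • (⊤ : Submodule R M) → ϖ ^ k ∣ b.repr x i := by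
    intro k hk
    obtain ⟨s, -, hs⟩ := (mem_smul_pointwise_iff_exists _ _ _).mp hk
    refine ⟨b.repr s i, ?_⟩
    rw [← hs, map_smul, Finsupp.smul_apply, smul_eq_mul]
  -- finiteness of the exponent: `ϖ^k ∣ c` with `c ≠ 0` bounds `k`
  obtain ⟨N, hN⟩ : ∃ N, ¬ ϖ ^ N ∣ b.repr x i := by
    obtain ⟨N, hN⟩ := FiniteMultiplicity.of_not_isUnit hϖ.not_isUnit hi
    exact ⟨N + 1, hN⟩
  -- take the largest `m < N` with `P m`
  obtain ⟨m, hm, hmax⟩ : ∃ m, x ∈ ϖ ^ m • (⊤ : Submodule R M) ∧ x ∉ ϖ ^ (m + 1) • (⊤ : Submodule R M) := by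
    by_contra h
    push Not at h
    have : ∀ k, x ∈ ϖ ^ k • (⊤ : Submodule R M) := fun k => Nat.rec hP0 (fun k ih => h k ih) k
    exact hN (hbound N (this N))
  obtain ⟨y, -, hy⟩ := (mem_smul_pointwise_iff_exists _ _ _).mp hm
  refine ⟨m, y, hy.symm, fun hy' => hmax ?_⟩
  obtain ⟨z, -, hz⟩ := (mem_smul_pointwise_iff_exists _ _ _).mp hy'
  exact (mem_smul_pointwise_iff_exists _ _ _).mpr ⟨z, mem_top, by rw [pow_succ, mul_smul, hz, hy]⟩

/-- **The span of the `GL(M)`-orbit of any nonzero vector** over a DVR is `ϖ^m • M` for the `m` with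
`x ∈ ϖ^m M ∖ ϖ^{m+1} M`. [folklore] -/
theorem exists_span_orbit_eq_smul_top {ϖ : R} (hϖ : Irreducible ϖ) {x : M} (hx : x ≠ 0) :
    ∃ m : ℕ, x ∈ ϖ ^ m • (⊤ : Submodule R M) ∧ x ∉ ϖ ^ (m + 1) • (⊤ : Submodule R M) ∧
      span R (Set.range fun g : M ≃ₗ[R] M => g x) = ϖ ^ m • (⊤ : Submodule R M) := by
  obtain ⟨m, y, rfl, hy⟩ := exists_eq_pow_smul_not_mem hϖ hx
  refine ⟨m, smul_mem_pointwise_smul _ _ _ mem_top, fun h => hy ?_, span_orbit_eq_smul_top hϖ m hy⟩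
  -- `ϖ^m • y ∈ ϖ^{m+1} • M` would put `y` in `ϖ • M` (cancel `ϖ^m` in the torsion-free module `M`)
  obtain ⟨z, -, hz⟩ := (mem_smul_pointwise_iff_exists _ _ _).mp h
  have hϖ0 : (ϖ ^ m : R) ≠ 0 := pow_ne_zero _ hϖ.ne_zero
  have : y = ϖ • z := by
    have h2 : ϖ ^ m • y = ϖ ^ m • (ϖ • z) := by rw [← hz, pow_succ, mul_smul]
    exact smul_right_injective M hϖ0 h2
  exact (mem_smul_pointwise_iff_exists _ _ _).mpr ⟨z, mem_top, this.symm⟩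

end DVR

section PadicInt

variable {p : ℕ} [Fact p.Prime]
variable {M : Type*} [AddCommGroup M] [Module ℤ_[p] M] [Module.Free ℤ_[p] M] [Module.Finite ℤ_[p] M]

/-- **`ℤ_p`-lattices**: for `y ∉ pM`, the `ℤ_p`-span of the `GL(M)`-orbit of `p^m • y` is `p^m • M`. [folklore] -/
theorem span_orbit_eq_smul_top_padicInt (m : ℕ) {y : M} (hy : y ∉ (p : ℤ_[p]) • (⊤ : Submodule ℤ_[p] M)) :
    span ℤ_[p] (Set.range fun g : M ≃ₗ[ℤ_[p]] M => g ((p : ℤ_[p]) ^ m • y)) =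
      (p : ℤ_[p]) ^ m • (⊤ : Submodule ℤ_[p] M) :=
  span_orbit_eq_smul_top PadicInt.irreducible_p m hy

/-- **`ℤ_p`-lattices, any nonzero vector**: the `ℤ_p`-span of the `GL(M)`-orbit of `x ≠ 0` is `p^m • M` with
`x ∈ p^m M ∖ p^{m+1} M`. [folklore] -/
theorem exists_span_orbit_eq_smul_top_padicInt {x : M} (hx : x ≠ 0) :
    ∃ m : ℕ, x ∈ (p : ℤ_[p]) ^ m • (⊤ : Submodule ℤ_[p] M) ∧
      x ∉ (p : ℤ_[p]) ^ (m + 1) • (⊤ : Submodule ℤ_[p] M) ∧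
      span ℤ_[p] (Set.range fun g : M ≃ₗ[ℤ_[p]] M => g x) = (p : ℤ_[p]) ^ m • (⊤ : Submodule ℤ_[p] M) :=
  exists_span_orbit_eq_smul_top PadicInt.irreducible_p hx

end PadicInt

section FullLattice

/-! ## Full lattices in a `K`-vector space: extension of lattice automorphisms and the `latticeAut`-orbit span -/

open Literature.IUT.LogVolume

variable {A : Type*} [CommRing A] [IsDomain A] {K : Type*} [Field K] [Algebra A K] [Module.IsTorsionFree A K]
variable {W : Type*} [AddCommGroup W] [Module K W] [Module A W] [IsScalarTower A K W]
variable {ι : Type*} [Fintype ι] (c : Basis ι K W)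

omit [Fintype ι] in
/-- The full lattice `span_A (range c)` of a `K`-basis `c` is a free `A`-module (Mathlib `Basis.restrictScalars`;
stated as a theorem, used via `haveI`). [folklore] -/
theorem free_span_range : Module.Free A (span A (Set.range c)) := Module.Free.of_basis (c.restrictScalars A)

/-- … and a finitely generated one. [folklore] -/
theorem finite_span_range : Module.Finite A (span A (Set.range c)) := Module.Finite.of_basis (c.restrictScalars A)

omit [Fintype ι] in
/-- **Extension of lattice automorphisms.** For the full lattice `Λ = span_A (range c)` of a `K`-basis `c` of `W`,
every `A`-linear automorphism `g` of `Λ` is the restriction of a `K`-linear automorphism `φ` of `W`; such a `φ`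
lies in `latticeAut K Λ` (`mem_latticeAut_of_restricts`). Construction: `φ`, `φ⁻¹` are the `K`-linear extensions
of `g`, `g⁻¹` on the basis `c`. [folklore] -/
theorem exists_latticeAut_extends (g : span A (Set.range c) ≃ₗ[A] span A (Set.range c)) :
    ∃ φ : W ≃ₗ[K] W, φ ∈ latticeAut K (span A (Set.range c)) ∧
      ∀ x : span A (Set.range c), φ x = g x := by
  classical
  let bΛ : Basis ι A (span A (Set.range c)) := c.restrictScalars A
  have hbΛ : ∀ i, (bΛ i : W) = c i := fun i => c.restrictScalars_apply A i
  -- the `K`-linear extensions of `g` and `g⁻¹`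
  let φ₀ : W →ₗ[K] W := c.constr K fun i => ((g (bΛ i) : span A (Set.range c)) : W)
  let ψ₀ : W →ₗ[K] W := c.constr K fun i => ((g.symm (bΛ i) : span A (Set.range c)) : W)
  -- they restrict to `g`, `g⁻¹` on `Λ`
  have hφ₀ : ∀ x : span A (Set.range c), φ₀ x = g x := by
    intro x
    have key : (φ₀.restrictScalars A) ∘ₗ (span A (Set.range c)).subtype = (span A (Set.range c)).subtype ∘ₗ (g : span A (Set.range c) →ₗ[A] span A (Set.range c)) := by
      refine bΛ.ext fun i => ?_
      simp only [LinearMap.coe_comp, Function.comp_apply, Submodule.coe_subtype, LinearMap.coe_restrictScalars,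
        LinearEquiv.coe_coe, hbΛ, φ₀, Basis.constr_basis]
    exact LinearMap.congr_fun key x
  have hψ₀ : ∀ x : span A (Set.range c), ψ₀ x = g.symm x := by
    intro x
    have key : (ψ₀.restrictScalars A) ∘ₗ (span A (Set.range c)).subtype = (span A (Set.range c)).subtype ∘ₗ (g.symm : span A (Set.range c) →ₗ[A] span A (Set.range c)) := by
      refine bΛ.ext fun i => ?_
      simp only [LinearMap.coe_comp, Function.comp_apply, Submodule.coe_subtype, LinearMap.coe_restrictScalars,
        LinearEquiv.coe_coe, hbΛ, ψ₀, Basis.constr_basis]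
    exact LinearMap.congr_fun key x
  have h₁ : φ₀ ∘ₗ ψ₀ = LinearMap.id := by
    refine c.ext fun i => ?_
    simp only [LinearMap.coe_comp, Function.comp_apply, LinearMap.id_coe, id_eq]
    rw [← hbΛ i, hψ₀, hφ₀, LinearEquiv.apply_symm_apply]
  have h₂ : ψ₀ ∘ₗ φ₀ = LinearMap.id := by
    refine c.ext fun i => ?_
    simp only [LinearMap.coe_comp, Function.comp_apply, LinearMap.id_coe, id_eq]
    rw [← hbΛ i, hφ₀, hψ₀, LinearEquiv.symm_apply_apply]
  have hφ : ∀ x : span A (Set.range c), (LinearEquiv.ofLinear φ₀ ψ₀ h₁ h₂) x = g x := fun x => by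
    rw [LinearEquiv.ofLinear_apply]; exact hφ₀ x
  exact ⟨LinearEquiv.ofLinear φ₀ ψ₀ h₁ h₂, mem_latticeAut_of_restricts _ g fun x => (hφ x).symm, hφ⟩

omit [IsDomain A] [Module.IsTorsionFree A K] in
/-- `A`-scalars pass through `K`-linear automorphisms of `W` (scalar tower). [folklore] -/
theorem linearEquiv_map_smul_of_tower (φ : W ≃ₗ[K] W) (a : A) (w : W) : φ (a • w) = a • φ w :=
  LinearMap.map_smul_of_tower φ.toLinearMap a w

variable [IsDiscreteValuationRing A]

/-- **The span of a `latticeAut`-orbit.** For a DVR `A` with uniformiser `ϖ`, the full lattice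
`Λ = span_A (range c)`, `y ∈ Λ ∖ ϖΛ` and `m : ℕ`: the `A`-span of `{φ (ϖ^m • y) | φ ∈ latticeAut K Λ}` is EXACTLY
`ϖ^m • Λ`. (`⊆`: `φ (ϖ^m y) = ϖ^m φ y`, `φ y ∈ Λ`; `⊇`: `span_orbit_eq_smul_top` inside `Λ` + extension.)
[folklore] -/
theorem span_latticeAut_orbit_eq {ϖ : A} (hϖ : Irreducible ϖ) (m : ℕ) {y : W}
    (hyΛ : y ∈ span A (Set.range c)) (hy : y ∉ ϖ • span A (Set.range c)) :
    span A {z : W | ∃ φ ∈ latticeAut K (span A (Set.range c)), φ (ϖ ^ m • y) = z} =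
      ϖ ^ m • span A (Set.range c) := by
  classical
  set Λ := span A (Set.range c)
  apply le_antisymm
  · rw [span_le]
    rintro _ ⟨φ, hφ, rfl⟩
    rw [linearEquiv_map_smul_of_tower]
    exact smul_mem_pointwise_smul _ _ _ ((hφ y).mpr hyΛ)
  · -- work inside `Λ`
    let y' : Λ := ⟨y, hyΛ⟩
    have hy' : y' ∉ ϖ • (⊤ : Submodule A Λ) := by
      intro h
      obtain ⟨s, -, hs⟩ := (mem_smul_pointwise_iff_exists _ _ _).mp h
      refine hy ((mem_smul_pointwise_iff_exists _ _ _).mpr ⟨(s : W), s.2, ?_⟩)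
      have := congrArg (fun z : Λ => (z : W)) hs
      simpa using this
    haveI := free_span_range (A := A) c
    haveI := finite_span_range (A := A) c
    have hin := span_orbit_eq_smul_top (M := Λ) hϖ m hy'
    intro z hz
    obtain ⟨s, hs, rfl⟩ := (mem_smul_pointwise_iff_exists _ _ _).mp hz
    -- `ϖ^m • ⟨s, hs⟩` lies in the orbit span inside `Λ`; push forward along `Λ.subtype`
    have hs' : ϖ ^ m • (⟨s, hs⟩ : Λ) ∈ span A (Set.range fun g : Λ ≃ₗ[A] Λ => g (ϖ ^ m • y')) := by
      rw [hin]; exact smul_mem_pointwise_smul _ _ _ mem_top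
    have hmap := Submodule.mem_map_of_mem (f := Λ.subtype) hs'
    rw [Submodule.map_span] at hmap
    have hsub : (Λ.subtype : Λ → W) '' (Set.range fun g : Λ ≃ₗ[A] Λ => g (ϖ ^ m • y')) ⊆
        {z : W | ∃ φ ∈ latticeAut K Λ, φ (ϖ ^ m • y) = z} := by
      rintro _ ⟨_, ⟨g, rfl⟩, rfl⟩
      obtain ⟨φ, hφ, hext⟩ := exists_latticeAut_extends c g
      refine ⟨φ, hφ, ?_⟩
      rw [Submodule.coe_subtype, ← hext (ϖ ^ m • y')]
      rfl
    exact span_mono hsub (by simpa using hmap)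

/-- **The span of the `latticeAut`-orbit of ANY nonzero lattice vector**: for `x ∈ Λ`, `x ≠ 0`, there is `m` with
`x ∈ ϖ^m Λ ∖ ϖ^{m+1} Λ` and the `A`-span of `{φ x | φ ∈ latticeAut K Λ}` is `ϖ^m • Λ`. [folklore] -/
theorem exists_span_latticeAut_orbit_eq {ϖ : A} (hϖ : Irreducible ϖ) {x : W} (hxΛ : x ∈ span A (Set.range c))
    (hx : x ≠ 0) :
    ∃ m : ℕ, x ∈ ϖ ^ m • span A (Set.range c) ∧ x ∉ ϖ ^ (m + 1) • span A (Set.range c) ∧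
      span A {z : W | ∃ φ ∈ latticeAut K (span A (Set.range c)), φ x = z} = ϖ ^ m • span A (Set.range c) := by
  classical
  set Λ := span A (Set.range c)
  have hx' : (⟨x, hxΛ⟩ : Λ) ≠ 0 := fun h => hx (by simpa using congrArg (fun z : Λ => (z : W)) h)
  haveI := free_span_range (A := A) c
  haveI := finite_span_range (A := A) c
  obtain ⟨m, y', hxy, hy'⟩ := exists_eq_pow_smul_not_mem (M := Λ) hϖ hx'
  have hxy' : x = ϖ ^ m • (y' : W) := by simpa using congrArg (fun z : Λ => (z : W)) hxy
  have hy : (y' : W) ∉ ϖ • Λ := by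
    intro h
    obtain ⟨s, hs, hs'⟩ := (mem_smul_pointwise_iff_exists _ _ _).mp h
    exact hy' ((mem_smul_pointwise_iff_exists _ _ _).mpr ⟨⟨s, hs⟩, mem_top, by ext; simpa using hs'⟩)
  refine ⟨m, ?_, ?_, ?_⟩
  · rw [hxy']; exact smul_mem_pointwise_smul _ _ _ y'.2
  · intro h
    obtain ⟨s, hs, hs'⟩ := (mem_smul_pointwise_iff_exists _ _ _).mp h
    apply hy
    refine (mem_smul_pointwise_iff_exists _ _ _).mpr ⟨s, hs, ?_⟩
    have hϖ0 : (ϖ ^ m : A) ≠ 0 := pow_ne_zero _ hϖ.ne_zero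
    have h2 : ϖ ^ m • (ϖ • s) = ϖ ^ m • (y' : W) := by rw [← hxy', ← hs', pow_succ, mul_smul]
    -- cancel `ϖ^m` in `W`, torsion-free over `A` through the tower `A → K → W`
    haveI : Module.IsTorsionFree A W := Module.IsTorsionFree.trans K
    exact smul_right_injective W hϖ0 h2
  · rw [hxy']; exact span_latticeAut_orbit_eq c hϖ m y'.2 hy

end FullLattice

end Summit.ABC.IUTFork.LatticeOrbit
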